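import Summits.Ventures.YMGap.Thresholds.OneLinkOmegaBound
import HarnessLib

/-!
# Venture YMGap — the one-link modulus beyond first order, part 31: the `ω`-REFINED level-two one-link
# Kantorovich–Rubinstein modulus `K₂ᴼ(N, R)` for every `SU(N)`, `N ≥ 3`, hypothesis-free

HONEST FRAMING: venture file of the cell `pub-ymgap` (QuantumFields programme), strong-coupling LATTICE bookkeeping for `SU(N)`
lattice Yang–Mills; nothing about the continuum or the mass gap in the Clay sense.  Same assembly as `OneLinkLevelTwoSD`
(`levelTwo_algebraW`: covariance hierarchy at second order, exact Casimir decomposition, Schwinger–Dyson second moments, Bakry–Émery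
only on the cubic remainder), with ONE input replaced: the `L²(ν_B)` gradient norm of the linear statistic `u = Re tr(·Δ)` enters
through `√(E_ν Γ(u,u)) ≤ ‖Δ‖_F √((1+ω⁺)/2)` (`OneLinkOmegaBound.sqrt_integral_Gam_upsi_le_omegaPlus`: `Γ(u,u) = ½‖Δ‖² − ½Re tr(gΔgΔ)
− (Im tr gΔ)²/N` integrated, the quadratic mean by Schwinger–Dyson) instead of the pointwise `Γ(u,u) ≤ ‖Δ‖_F²`.  The A-part `1` of
`K₂ˢ` becomes `a₀(N,R) = √((1+ω⁺(N,R))/2) < 1`.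

WHAT.  With `E = N²/(2(N²−4))`, `C = N²/(N²−1)`, `s = √(R²/4 + 1/N²)`, `ω̂ = R²/2 + R s`, `a = 2N − 4/N`, `c₁ = Na/(a²−4)`, `c₂ = 2N/(a²−4)`,
`ω⁺ = 2c₁(R + ω̂) + 2c₂N(ω̂ + R(R/2+s)²)`:
  `K₂ᴼ(N,R) = C·( √((1+ω⁺)/2) + E R + 2(E+¼)·ω̂ + [ (5E+¼)R² + (10E+½)·R·ω̂ ] / (½ − R) )`.
* `levelTwo_algebraWA`: the real-arithmetic assembly with an abstract A-part `a₀` and second-moment scale `W`;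
* `cov_linear_le_levelTwoO_explicit`: `|Cov_{ν_B}(φ, N Re tr(·Δ))| ≤ K₂ᴼ(N, ‖B‖_op)·L·‖Δ‖_F`;
* `omegaPlus_mono`, `levelTwoOBody_mono`; `oneLinkKRModulus_levelTwoO (hN : 3 ≤ N) (hR : R < 1/2) : OneLinkKRModulus N R (K₂ᴼ(N,R))`.
Numbers (float screen `work/hier/k2_levers.py` of this seat): `ω⁺(10, 0.24) = 0.405`, `a₀ = 0.838`; `K₂ᴼ(10, 0.24) = 2.07` against
`K₂ˢ = 2.23`; through ds-1's star door the all-`N` `d = 4` rows move `1/25 → 0.0412` (`N ≥ 10`), `81/2000 → 0.0419` (`N ≥ 20`),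
`0.0410 → 0.0421` (`N ≥ 50`) — next file.  Sentence-grade, not a headline.

References: cell notes `HOME/p2/ONE-LINK-HIERARCHY.md` §4–§5, §13 (1); Shen–Zhu–Zhu CMP 400 (2023) §4.1.
-/

noncomputable section

open scoped Matrix ComplexConjugate BigOperators ContDiff Matrix.Norms.Frobenius
open Matrix Complex Finset MeasureTheory ProbabilityTheory
open Literature.MathematicalPhysics.QuantumFieldTheory
open Literature.MathematicalPhysics.QuantumFieldTheory.SUNBakryEmery
open Literature.MathematicalPhysics.QuantumFieldTheory.Balaban1983to89.StrongCouplingDobrushinWindow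
open Literature.MathematicalPhysics.QuantumFieldTheory.Balaban1983to89.StrongCouplingKernelWindow

namespace Summit.Ventures.YMGap.OneLinkEigen

variable {N : ℕ}

/-! ### The real-arithmetic assembly with an abstract A-part -/

/-- Coefficient identity for the `u + ψ₂` gradient norm with an abstract A-part `a₀`. [folklore] -/
theorem levelTwo_idAWA (hN : (N : ℝ) ≠ 0) (E W r a0 : ℝ) :
    a0 + 2 * (E / 2) * r + 2 * (E / N + 1 / (4 * (N : ℝ))) * W =
      a0 + E * r + 2 * ((E + 1 / 4) / N) * W := by
  field_simp

/-- **Assembly of the level-two bound with an abstract A-part `a₀` and second-moment scale `W`** (pure real arithmetic): as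
`levelTwo_algebraW`, but the `u + ψ₂` gradient norm enters through `nD·a₀ + 2κ_w r nD + κ₁(nD Z₁ + nB Z₂)`. [folklore] -/
theorem levelTwo_algebraWA (hN : 3 ≤ N) {r nB nD L Z₁ Z₂ GΨ Gc V S C W KW KT CC E a0 : ℝ}
    (hS : S = Real.sqrt N) (hCdef : C = (N : ℝ) ^ 2 / ((N : ℝ) ^ 2 - 1))
    (hKW : KW = (N : ℝ) ^ 2 / (4 * ((N : ℝ) ^ 2 - 4))) (hKT : KT = (N : ℝ) / (2 * ((N : ℝ) ^ 2 - 4)))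
    (hCC : CC = 1 / (4 * (N : ℝ))) (hE : E = (N : ℝ) ^ 2 / (2 * ((N : ℝ) ^ 2 - 4)))
    (hr0 : 0 ≤ r) (hr : r < 1 / 2) (hnB0 : 0 ≤ nB) (hnD0 : 0 ≤ nD) (hL : 0 ≤ L) (hnB : nB ≤ S * r)
    (hW0 : 0 ≤ W) (F1 : Z₁ ≤ W) (F2 : nB * Z₂ ≤ nD * W)
    (hΨ : GΨ ≤ (nD * a0 + KW * (2 * r * nD)) + (KT + CC) * nD * Z₁ + (KT + CC) * nB * Z₂)
    (hc : Gc ≤ (4 * KW * r ^ 2 * nD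
          + nB ^ 2 * nD * (2 * KW / N + 3 / 2 * (KT + CC) + 1 / 2 * (KT - CC)))
        + nD * r * (4 * KW / N + (KT + CC) + 2 * KT) * Z₁
        + nB * ((KT + CC) * r + 2 * KT * r + 2 * KT / N * S * nB) * Z₂)
    (hcov : V ≤ C * L * (GΨ + Gc / (1 / 2 - r))) :
    V ≤ C * (a0 + E * r + 2 * ((E + 1 / 4) / N) * W
          + ((5 * E + 1 / 4) * r ^ 2 + ((10 * E + 1 / 2) / N) * r * W) / (1 / 2 - r)) * L * nD := by
  have h3 : (3 : ℝ) ≤ N := by exact_mod_cast hN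
  have hN4 : (0 : ℝ) < (N : ℝ) ^ 2 - 4 := by nlinarith only [h3]
  have hN1 : (0 : ℝ) < (N : ℝ) ^ 2 - 1 := by nlinarith only [h3]
  have hNpos : (0 : ℝ) < N := by linarith only [h3]
  have hNne : (N : ℝ) ≠ 0 := hNpos.ne'
  have hT : 0 < 1 / 2 - r := by linarith only [hr]
  have hSpos : 0 < S := by rw [hS]; exact Real.sqrt_pos.2 hNpos
  have hS2 : S * S = N := by rw [hS]; exact Real.mul_self_sqrt hNpos.le
  have hC0 : 0 ≤ C := by rw [hCdef]; exact div_nonneg (by positivity) hN1.le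
  have hKW0 : 0 ≤ KW := by rw [hKW]; positivity
  have hKT0 : 0 ≤ KT := by rw [hKT]; positivity
  have hCC0 : 0 ≤ CC := by rw [hCC]; positivity
  have hcκ : CC ≤ KT := by
    rw [hCC, hKT, div_le_div_iff₀ (by positivity) (by positivity)]
    nlinarith only [h3]
  have hK1 : 0 ≤ KT + CC := add_nonneg hKT0 hCC0
  have hKm : 0 ≤ KT - CC := by linarith only [hcκ]
  have eKW : KW = E / 2 := by rw [hKW, hE]; field_simp; try ring
  have eKT : KT = E / N := by rw [hKT, hE]; field_simp; try ring
  have F3 : nB ^ 2 ≤ N * r ^ 2 := by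
    calc nB ^ 2 ≤ (S * r) ^ 2 := pow_le_pow_left₀ hnB0 hnB 2
      _ = (S * S) * r ^ 2 := by ring
      _ = N * r ^ 2 := by rw [hS2]
  have F4 : S * nB ≤ N * r := by
    calc S * nB ≤ S * (S * r) := mul_le_mul_of_nonneg_left hnB hSpos.le
      _ = (S * S) * r := by ring
      _ = N * r := by rw [hS2]
  -- (i) the `u + ψ₂` gradient norm, (ii) the cubic-remainder gradient norm
  have m1' := levelTwo_m1 hK1 hnD0 F1 F2 hΨ
  have m1 : GΨ ≤ nD * (a0 + 2 * KW * r + 2 * (KT + CC) * W) := m1'.trans (le_of_eq (by ring))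
  have m2 := levelTwo_m2 hNne hKW0 hKT0 hCC0 hKm hr0 hnB0 hnD0 hW0 hSpos.le hNpos.le F1 F2 F3 F4 hc
  -- (iii) combine
  have hsum : GΨ + Gc / (1 / 2 - r) ≤ nD * (a0 + 2 * KW * r + 2 * (KT + CC) * W)
      + nD * (4 * KW * r ^ 2 + N * r ^ 2 * (2 * KW / N + 3 / 2 * (KT + CC) + 1 / 2 * (KT - CC))
        + r * (4 * KW / N + (KT + CC) + 2 * KT) * W
        + r * ((KT + CC) + 4 * KT) * W) / (1 / 2 - r) :=
    add_le_add m1 (div_le_div_of_nonneg_right m2 hT.le)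
  have hCL : 0 ≤ C * L := mul_nonneg hC0 hL
  have hmain := hcov.trans (mul_le_mul_of_nonneg_left hsum hCL)
  -- (iv) rewrite the coefficients in terms of `E`
  rw [eKW, eKT, hCC, levelTwo_idAWA hNne, levelTwo_idCW hNne] at hmain
  refine hmain.trans (le_of_eq ?_)
  ring

/-! ### The explicit `ω`-refined second-order covariance bound -/

/-- **THE `ω`-REFINED SECOND-ORDER COVARIANCE BOUND, explicit.**  `N ≥ 3`, `‖B‖_op < 1/2`, `φ` bounded measurable `L`-Lipschitz
(Frobenius) on `SU(N)`: `|∫ φ · N Re tr(gΔ) dν_B − ∫ φ dν_B ∫ N Re tr(gΔ) dν_B| ≤ K₂ᴼ(N, ‖B‖_op) · L · ‖Δ‖_F`. [folklore] -/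
theorem cov_linear_le_levelTwoO_explicit (hN : 3 ≤ N) {B : Matrix (Fin N) (Fin N) ℂ} (hB : matrixOpNorm B < 1 / 2)
    (Δ : Matrix (Fin N) (Fin N) ℂ) (φ : SUN N → ℝ) {L : ℝ} (hφm : Measurable φ) (hφb : ∃ C, ∀ s, |φ s| ≤ C)
    (hL : 0 ≤ L) (hφL : ∀ a b, |φ a - φ b| ≤ L * suFrobDist a b) :
    |∫ s, φ s * ((N : ℝ) * ((s : Matrix (Fin N) (Fin N) ℂ) * Δ).trace.re)
          ∂(haarProbability (SUN N)).tilted (fun g => (N : ℝ) * ((g : Matrix (Fin N) (Fin N) ℂ) * B).trace.re) -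
        (∫ s, φ s ∂(haarProbability (SUN N)).tilted (fun g => (N : ℝ) * ((g : Matrix (Fin N) (Fin N) ℂ) * B).trace.re)) *
          ∫ s, (N : ℝ) * ((s : Matrix (Fin N) (Fin N) ℂ) * Δ).trace.re
            ∂(haarProbability (SUN N)).tilted (fun g => (N : ℝ) * ((g : Matrix (Fin N) (Fin N) ℂ) * B).trace.re)| ≤
      ((N : ℝ) ^ 2 / ((N : ℝ) ^ 2 - 1)) *
        (Real.sqrt ((1 +
            (2 * ((N : ℝ) * (2 * (N : ℝ) - 4 / N) / ((2 * (N : ℝ) - 4 / N) ^ 2 - 4)) *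
            (matrixOpNorm B + (matrixOpNorm B ^ 2 / 2 + matrixOpNorm B * Real.sqrt (matrixOpNorm B ^ 2 / 4 + 1 / (N : ℝ) ^ 2)))
          + 2 * (2 * (N : ℝ) / ((2 * (N : ℝ) - 4 / N) ^ 2 - 4)) * N *
            ((matrixOpNorm B ^ 2 / 2 + matrixOpNorm B * Real.sqrt (matrixOpNorm B ^ 2 / 4 + 1 / (N : ℝ) ^ 2))
              + matrixOpNorm B * (matrixOpNorm B / 2 + Real.sqrt (matrixOpNorm B ^ 2 / 4 + 1 / (N : ℝ) ^ 2)) ^ 2))) / 2)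
          + ((N : ℝ) ^ 2 / (2 * ((N : ℝ) ^ 2 - 4))) * matrixOpNorm B + 2 * (((N : ℝ) ^ 2 / (2 * ((N : ℝ) ^ 2 - 4))) + 1 / 4) * (matrixOpNorm B ^ 2 / 2 + matrixOpNorm B * Real.sqrt (matrixOpNorm B ^ 2 / 4 + 1 / (N : ℝ) ^ 2))
          + ((5 * ((N : ℝ) ^ 2 / (2 * ((N : ℝ) ^ 2 - 4))) + 1 / 4) * matrixOpNorm B ^ 2 + (10 * ((N : ℝ) ^ 2 / (2 * ((N : ℝ) ^ 2 - 4))) + 1 / 2) * matrixOpNorm B * (matrixOpNorm B ^ 2 / 2 + matrixOpNorm B * Real.sqrt (matrixOpNorm B ^ 2 / 4 + 1 / (N : ℝ) ^ 2))) / (1 / 2 - matrixOpNorm B)) * L * frobNorm Δ := by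
  have hN0 : N ≠ 0 := by omega
  have h3 : (3 : ℝ) ≤ N := by exact_mod_cast hN
  have hNpos : (0 : ℝ) < N := by linarith
  have hNne : (N : ℝ) ≠ 0 := hNpos.ne'
  have hr0 := matrixOpNorm_nonneg B
  have hB0 := frobNorm_nonneg B
  have hD0 := frobNorm_nonneg Δ
  have hW := levelTwoS_scale hNpos hB0 (frobNorm_le_sqrt_mul_matrixOpNorm B) hr0
  have hW0 : 0 ≤ (N : ℝ) * (matrixOpNorm B ^ 2 / 2 + matrixOpNorm B * Real.sqrt (matrixOpNorm B ^ 2 / 4 + 1 / (N : ℝ) ^ 2)) :=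
    mul_nonneg hNpos.le (levelTwoS_om_nonneg hr0)
  have hZ1 : Real.sqrt (∫ g, ‖((g : Matrix (Fin N) (Fin N) ℂ) * B).trace‖ ^ 2 ∂(haarProbability (SUN N)).tilted (fun g => (N : ℝ) * ((g : Matrix (Fin N) (Fin N) ℂ) * B).trace.re)) ≤
      (N : ℝ) * (matrixOpNorm B ^ 2 / 2 + matrixOpNorm B * Real.sqrt (matrixOpNorm B ^ 2 / 4 + 1 / (N : ℝ) ^ 2)) :=
    (sqrt_integral_normSq_trace_le_sd hN0 B B).trans hW
  have hZ2 : frobNorm B * Real.sqrt (∫ g, ‖((g : Matrix (Fin N) (Fin N) ℂ) * Δ).trace‖ ^ 2 ∂(haarProbability (SUN N)).tilted (fun g => (N : ℝ) * ((g : Matrix (Fin N) (Fin N) ℂ) * B).trace.re)) ≤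
      frobNorm Δ * ((N : ℝ) * (matrixOpNorm B ^ 2 / 2 + matrixOpNorm B * Real.sqrt (matrixOpNorm B ^ 2 / 4 + 1 / (N : ℝ) ^ 2))) := by
    have h := sqrt_integral_normSq_trace_le_sd hN0 B Δ
    calc frobNorm B * Real.sqrt (∫ g, ‖((g : Matrix (Fin N) (Fin N) ℂ) * Δ).trace‖ ^ 2 ∂(haarProbability (SUN N)).tilted (fun g => (N : ℝ) * ((g : Matrix (Fin N) (Fin N) ℂ) * B).trace.re))
        ≤ frobNorm B * (frobNorm Δ * (frobNorm B / 2 + Real.sqrt (frobNorm B ^ 2 / 4 + 1 / N))) := mul_le_mul_of_nonneg_left h hB0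
      _ = frobNorm Δ * (frobNorm B * (frobNorm B / 2 + Real.sqrt (frobNorm B ^ 2 / 4 + 1 / N))) := by ring
      _ ≤ _ := mul_le_mul_of_nonneg_left hW hD0
  refine (levelTwo_algebraWA hN rfl rfl rfl rfl rfl rfl hr0 hB hB0 hD0 hL (frobNorm_le_sqrt_mul_matrixOpNorm B) hW0 hZ1 hZ2
    (sqrt_integral_Gam_upsi_le_omegaPlus hN B Δ) (sqrt_integral_Gam_c3_le hN B Δ)
    (cov_linear_le_levelTwo hN hB Δ φ hφm hφb hL hφL)).trans (le_of_eq ?_)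
  rw [levelTwo_idW1 hNne, levelTwo_idW2 hNne]

/-! ### Monotonicity and the modulus -/

/-- `ω⁺(N, ·)` is increasing on `[0, ∞)` (`N ≥ 3`). [folklore] -/
theorem omegaPlus_mono (hN : 3 ≤ N) {r R : ℝ} (hr : 0 ≤ r) (hrR : r ≤ R) :
    (2 * ((N : ℝ) * (2 * (N : ℝ) - 4 / N) / ((2 * (N : ℝ) - 4 / N) ^ 2 - 4)) *
            (r + (r ^ 2 / 2 + r * Real.sqrt (r ^ 2 / 4 + 1 / (N : ℝ) ^ 2)))
          + 2 * (2 * (N : ℝ) / ((2 * (N : ℝ) - 4 / N) ^ 2 - 4)) * N *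
            ((r ^ 2 / 2 + r * Real.sqrt (r ^ 2 / 4 + 1 / (N : ℝ) ^ 2))
              + r * (r / 2 + Real.sqrt (r ^ 2 / 4 + 1 / (N : ℝ) ^ 2)) ^ 2)) ≤
      (2 * ((N : ℝ) * (2 * (N : ℝ) - 4 / N) / ((2 * (N : ℝ) - 4 / N) ^ 2 - 4)) *
            (R + (R ^ 2 / 2 + R * Real.sqrt (R ^ 2 / 4 + 1 / (N : ℝ) ^ 2)))
          + 2 * (2 * (N : ℝ) / ((2 * (N : ℝ) - 4 / N) ^ 2 - 4)) * N *
            ((R ^ 2 / 2 + R * Real.sqrt (R ^ 2 / 4 + 1 / (N : ℝ) ^ 2))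
              + R * (R / 2 + Real.sqrt (R ^ 2 / 4 + 1 / (N : ℝ) ^ 2)) ^ 2)) := by
  have h3 : (3 : ℝ) ≤ N := by exact_mod_cast hN
  have hNpos : (0 : ℝ) < N := by linarith only [h3]
  have hR0 : 0 ≤ R := hr.trans hrR
  set a : ℝ := 2 * (N : ℝ) - 4 / N with ha
  have ha4 : 4 < a := by
    have : (4 : ℝ) / N ≤ 4 / 3 := by rw [div_le_div_iff₀ hNpos (by norm_num)]; linarith only [h3]
    rw [ha]; linarith only [this, h3]
  have hden : 0 < a ^ 2 - 4 := by nlinarith only [ha4]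
  have hc1 : 0 ≤ (N : ℝ) * a / (a ^ 2 - 4) := div_nonneg (mul_nonneg hNpos.le (by linarith only [ha4])) hden.le
  have hc2 : 0 ≤ 2 * (N : ℝ) / (a ^ 2 - 4) := div_nonneg (by positivity) hden.le
  have p2 : r ^ 2 ≤ R ^ 2 := pow_le_pow_left₀ hr hrR 2
  have hs : Real.sqrt (r ^ 2 / 4 + 1 / (N : ℝ) ^ 2) ≤ Real.sqrt (R ^ 2 / 4 + 1 / (N : ℝ) ^ 2) :=
    Real.sqrt_le_sqrt (by linarith only [p2])
  have hs0 : 0 ≤ Real.sqrt (r ^ 2 / 4 + 1 / (N : ℝ) ^ 2) := Real.sqrt_nonneg _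
  have hw : r ^ 2 / 2 + r * Real.sqrt (r ^ 2 / 4 + 1 / (N : ℝ) ^ 2) ≤ R ^ 2 / 2 + R * Real.sqrt (R ^ 2 / 4 + 1 / (N : ℝ) ^ 2) := by
    have := mul_le_mul hrR hs hs0 hR0
    linarith only [this, p2]
  have hh : r / 2 + Real.sqrt (r ^ 2 / 4 + 1 / (N : ℝ) ^ 2) ≤ R / 2 + Real.sqrt (R ^ 2 / 4 + 1 / (N : ℝ) ^ 2) := by
    linarith only [hrR, hs]
  have hh0 : 0 ≤ r / 2 + Real.sqrt (r ^ 2 / 4 + 1 / (N : ℝ) ^ 2) := by positivity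
  have hq : (r / 2 + Real.sqrt (r ^ 2 / 4 + 1 / (N : ℝ) ^ 2)) ^ 2 ≤ (R / 2 + Real.sqrt (R ^ 2 / 4 + 1 / (N : ℝ) ^ 2)) ^ 2 :=
    pow_le_pow_left₀ hh0 hh 2
  have hrq : r * (r / 2 + Real.sqrt (r ^ 2 / 4 + 1 / (N : ℝ) ^ 2)) ^ 2 ≤ R * (R / 2 + Real.sqrt (R ^ 2 / 4 + 1 / (N : ℝ) ^ 2)) ^ 2 :=
    mul_le_mul hrR hq (by positivity) hR0
  have b1 := mul_le_mul_of_nonneg_left (add_le_add hrR hw) (mul_nonneg (by norm_num : (0 : ℝ) ≤ 2) hc1)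
  have b2 := mul_le_mul_of_nonneg_left (add_le_add hw hrq) (mul_nonneg (mul_nonneg (by norm_num : (0 : ℝ) ≤ 2) hc2) hNpos.le)
  linarith only [b1, b2]

/-- `0 ≤ ω⁺(N, r)` for `r ≥ 0` (`N ≥ 3`). [folklore] -/
theorem omegaPlus_nonneg (hN : 3 ≤ N) {r : ℝ} (hr : 0 ≤ r) :
    0 ≤ (2 * ((N : ℝ) * (2 * (N : ℝ) - 4 / N) / ((2 * (N : ℝ) - 4 / N) ^ 2 - 4)) *
            (r + (r ^ 2 / 2 + r * Real.sqrt (r ^ 2 / 4 + 1 / (N : ℝ) ^ 2)))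
          + 2 * (2 * (N : ℝ) / ((2 * (N : ℝ) - 4 / N) ^ 2 - 4)) * N *
            ((r ^ 2 / 2 + r * Real.sqrt (r ^ 2 / 4 + 1 / (N : ℝ) ^ 2))
              + r * (r / 2 + Real.sqrt (r ^ 2 / 4 + 1 / (N : ℝ) ^ 2)) ^ 2)) := by
  have h3 : (3 : ℝ) ≤ N := by exact_mod_cast hN
  have hNpos : (0 : ℝ) < N := by linarith only [h3]
  set a : ℝ := 2 * (N : ℝ) - 4 / N with ha
  have ha4 : 4 < a := by
    have : (4 : ℝ) / N ≤ 4 / 3 := by rw [div_le_div_iff₀ hNpos (by norm_num)]; linarith only [h3]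
    rw [ha]; linarith only [this, h3]
  have hden : 0 < a ^ 2 - 4 := by nlinarith only [ha4]
  have hc1 : 0 ≤ (N : ℝ) * a / (a ^ 2 - 4) := div_nonneg (mul_nonneg hNpos.le (by linarith only [ha4])) hden.le
  have hc2 : 0 ≤ 2 * (N : ℝ) / (a ^ 2 - 4) := div_nonneg (by positivity) hden.le
  positivity

/-- `K₂ᴼ(N, ·)` is increasing on `[0, 1/2)`. [folklore] -/
theorem levelTwoOBody_mono (hN : 3 ≤ N) {r R : ℝ} (hr : 0 ≤ r) (hrR : r ≤ R) (hR : R < 1 / 2) :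
    ((N : ℝ) ^ 2 / ((N : ℝ) ^ 2 - 1)) *
        (Real.sqrt ((1 +
            (2 * ((N : ℝ) * (2 * (N : ℝ) - 4 / N) / ((2 * (N : ℝ) - 4 / N) ^ 2 - 4)) *
            (r + (r ^ 2 / 2 + r * Real.sqrt (r ^ 2 / 4 + 1 / (N : ℝ) ^ 2)))
          + 2 * (2 * (N : ℝ) / ((2 * (N : ℝ) - 4 / N) ^ 2 - 4)) * N *
            ((r ^ 2 / 2 + r * Real.sqrt (r ^ 2 / 4 + 1 / (N : ℝ) ^ 2))
              + r * (r / 2 + Real.sqrt (r ^ 2 / 4 + 1 / (N : ℝ) ^ 2)) ^ 2))) / 2)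
          + ((N : ℝ) ^ 2 / (2 * ((N : ℝ) ^ 2 - 4))) * r + 2 * (((N : ℝ) ^ 2 / (2 * ((N : ℝ) ^ 2 - 4))) + 1 / 4) * (r ^ 2 / 2 + r * Real.sqrt (r ^ 2 / 4 + 1 / (N : ℝ) ^ 2))
          + ((5 * ((N : ℝ) ^ 2 / (2 * ((N : ℝ) ^ 2 - 4))) + 1 / 4) * r ^ 2 + (10 * ((N : ℝ) ^ 2 / (2 * ((N : ℝ) ^ 2 - 4))) + 1 / 2) * r * (r ^ 2 / 2 + r * Real.sqrt (r ^ 2 / 4 + 1 / (N : ℝ) ^ 2))) / (1 / 2 - r)) ≤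
      ((N : ℝ) ^ 2 / ((N : ℝ) ^ 2 - 1)) *
        (Real.sqrt ((1 +
            (2 * ((N : ℝ) * (2 * (N : ℝ) - 4 / N) / ((2 * (N : ℝ) - 4 / N) ^ 2 - 4)) *
            (R + (R ^ 2 / 2 + R * Real.sqrt (R ^ 2 / 4 + 1 / (N : ℝ) ^ 2)))
          + 2 * (2 * (N : ℝ) / ((2 * (N : ℝ) - 4 / N) ^ 2 - 4)) * N *
            ((R ^ 2 / 2 + R * Real.sqrt (R ^ 2 / 4 + 1 / (N : ℝ) ^ 2))
              + R * (R / 2 + Real.sqrt (R ^ 2 / 4 + 1 / (N : ℝ) ^ 2)) ^ 2))) / 2)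
          + ((N : ℝ) ^ 2 / (2 * ((N : ℝ) ^ 2 - 4))) * R + 2 * (((N : ℝ) ^ 2 / (2 * ((N : ℝ) ^ 2 - 4))) + 1 / 4) * (R ^ 2 / 2 + R * Real.sqrt (R ^ 2 / 4 + 1 / (N : ℝ) ^ 2))
          + ((5 * ((N : ℝ) ^ 2 / (2 * ((N : ℝ) ^ 2 - 4))) + 1 / 4) * R ^ 2 + (10 * ((N : ℝ) ^ 2 / (2 * ((N : ℝ) ^ 2 - 4))) + 1 / 2) * R * (R ^ 2 / 2 + R * Real.sqrt (R ^ 2 / 4 + 1 / (N : ℝ) ^ 2))) / (1 / 2 - R)) := by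
  have h3 : (3 : ℝ) ≤ N := by exact_mod_cast hN
  have hN4 : (0 : ℝ) < (N : ℝ) ^ 2 - 4 := by nlinarith only [h3]
  have hN1 : (0 : ℝ) < (N : ℝ) ^ 2 - 1 := by nlinarith only [h3]
  have hNpos : (0 : ℝ) < N := by linarith only [h3]
  set C : ℝ := (N : ℝ) ^ 2 / ((N : ℝ) ^ 2 - 1) with hC
  set E : ℝ := (N : ℝ) ^ 2 / (2 * ((N : ℝ) ^ 2 - 4)) with hE
  have hC0 : 0 ≤ C := div_nonneg (by positivity) hN1.le
  have hE0 : 0 ≤ E := by positivity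
  have hR0 : 0 ≤ R := hr.trans hrR
  have h1 : 0 < 1 / 2 - R := by linarith only [hR]
  have p2 : r ^ 2 ≤ R ^ 2 := pow_le_pow_left₀ hr hrR 2
  have hs : Real.sqrt (r ^ 2 / 4 + 1 / (N : ℝ) ^ 2) ≤ Real.sqrt (R ^ 2 / 4 + 1 / (N : ℝ) ^ 2) :=
    Real.sqrt_le_sqrt (by linarith only [p2])
  have hw : r ^ 2 / 2 + r * Real.sqrt (r ^ 2 / 4 + 1 / (N : ℝ) ^ 2) ≤ R ^ 2 / 2 + R * Real.sqrt (R ^ 2 / 4 + 1 / (N : ℝ) ^ 2) := by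
    have := mul_le_mul hrR hs (Real.sqrt_nonneg _) hR0
    linarith only [this, p2]
  have hw0 : 0 ≤ r ^ 2 / 2 + r * Real.sqrt (r ^ 2 / 4 + 1 / (N : ℝ) ^ 2) := levelTwoS_om_nonneg hr
  have hwR0 : 0 ≤ R ^ 2 / 2 + R * Real.sqrt (R ^ 2 / 4 + 1 / (N : ℝ) ^ 2) := levelTwoS_om_nonneg hR0
  have hrw : r * (r ^ 2 / 2 + r * Real.sqrt (r ^ 2 / 4 + 1 / (N : ℝ) ^ 2)) ≤
      R * (R ^ 2 / 2 + R * Real.sqrt (R ^ 2 / 4 + 1 / (N : ℝ) ^ 2)) := mul_le_mul hrR hw hw0 hR0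
  have hnum : (5 * E + 1 / 4) * r ^ 2 + (10 * E + 1 / 2) * r * (r ^ 2 / 2 + r * Real.sqrt (r ^ 2 / 4 + 1 / (N : ℝ) ^ 2)) ≤
      (5 * E + 1 / 4) * R ^ 2 + (10 * E + 1 / 2) * R * (R ^ 2 / 2 + R * Real.sqrt (R ^ 2 / 4 + 1 / (N : ℝ) ^ 2)) := by
    have a1 := mul_le_mul_of_nonneg_left p2 (by positivity : (0 : ℝ) ≤ 5 * E + 1 / 4)
    have a2 := mul_le_mul_of_nonneg_left hrw (by positivity : (0 : ℝ) ≤ 10 * E + 1 / 2)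
    have e1 : (10 * E + 1 / 2) * r * (r ^ 2 / 2 + r * Real.sqrt (r ^ 2 / 4 + 1 / (N : ℝ) ^ 2)) =
        (10 * E + 1 / 2) * (r * (r ^ 2 / 2 + r * Real.sqrt (r ^ 2 / 4 + 1 / (N : ℝ) ^ 2))) := by ring
    have e2 : (10 * E + 1 / 2) * R * (R ^ 2 / 2 + R * Real.sqrt (R ^ 2 / 4 + 1 / (N : ℝ) ^ 2)) =
        (10 * E + 1 / 2) * (R * (R ^ 2 / 2 + R * Real.sqrt (R ^ 2 / 4 + 1 / (N : ℝ) ^ 2))) := by ring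
    rw [e1, e2]
    linarith only [a1, a2]
  have hnum0 : 0 ≤ (5 * E + 1 / 4) * R ^ 2 + (10 * E + 1 / 2) * R * (R ^ 2 / 2 + R * Real.sqrt (R ^ 2 / 4 + 1 / (N : ℝ) ^ 2)) := by
    positivity
  have hfrac := div_le_div₀ hnum0 hnum h1 (by linarith only [hrR] : 1 / 2 - R ≤ 1 / 2 - r)
  have b0 : Real.sqrt ((1 +
            (2 * ((N : ℝ) * (2 * (N : ℝ) - 4 / N) / ((2 * (N : ℝ) - 4 / N) ^ 2 - 4)) *
            (r + (r ^ 2 / 2 + r * Real.sqrt (r ^ 2 / 4 + 1 / (N : ℝ) ^ 2)))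
          + 2 * (2 * (N : ℝ) / ((2 * (N : ℝ) - 4 / N) ^ 2 - 4)) * N *
            ((r ^ 2 / 2 + r * Real.sqrt (r ^ 2 / 4 + 1 / (N : ℝ) ^ 2))
              + r * (r / 2 + Real.sqrt (r ^ 2 / 4 + 1 / (N : ℝ) ^ 2)) ^ 2))) / 2) ≤
      Real.sqrt ((1 +
            (2 * ((N : ℝ) * (2 * (N : ℝ) - 4 / N) / ((2 * (N : ℝ) - 4 / N) ^ 2 - 4)) *
            (R + (R ^ 2 / 2 + R * Real.sqrt (R ^ 2 / 4 + 1 / (N : ℝ) ^ 2)))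
          + 2 * (2 * (N : ℝ) / ((2 * (N : ℝ) - 4 / N) ^ 2 - 4)) * N *
            ((R ^ 2 / 2 + R * Real.sqrt (R ^ 2 / 4 + 1 / (N : ℝ) ^ 2))
              + R * (R / 2 + Real.sqrt (R ^ 2 / 4 + 1 / (N : ℝ) ^ 2)) ^ 2))) / 2) :=
    Real.sqrt_le_sqrt (by linarith only [omegaPlus_mono hN hr hrR])
  have b1 := mul_le_mul_of_nonneg_left hrR hE0
  have b2 := mul_le_mul_of_nonneg_left hw (by positivity : (0 : ℝ) ≤ 2 * (E + 1 / 4))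
  exact mul_le_mul_of_nonneg_left (by linarith only [b0, b1, b2, hfrac]) hC0

/-- **THE `ω`-REFINED LEVEL-TWO ONE-LINK KANTOROVICH–RUBINSTEIN MODULUS, EVERY `SU(N)`, `N ≥ 3`, HYPOTHESIS-FREE**: for
`R < 1/2`, `OneLinkKRModulus N R (K₂ᴼ(N,R))`.  Proof: `cov_linear_le_levelTwoO_explicit` along the segment `B_t = B + t(B' − B)`
(convexity of the ball, `levelTwoOBody_mono`) and the tilt-interpolation lemma `abs_integral_tilted_add_sub_le_of_cov`.
[cite: arXiv220412737, Lemma 4.1 and Rem. 1.3] -/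
theorem oneLinkKRModulus_levelTwoO (hN : 3 ≤ N) {R : ℝ} (hR : R < 1 / 2) :
    OneLinkKRModulus N R
      (((N : ℝ) ^ 2 / ((N : ℝ) ^ 2 - 1)) *
        (Real.sqrt ((1 +
            (2 * ((N : ℝ) * (2 * (N : ℝ) - 4 / N) / ((2 * (N : ℝ) - 4 / N) ^ 2 - 4)) *
            (R + (R ^ 2 / 2 + R * Real.sqrt (R ^ 2 / 4 + 1 / (N : ℝ) ^ 2)))
          + 2 * (2 * (N : ℝ) / ((2 * (N : ℝ) - 4 / N) ^ 2 - 4)) * N *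
            ((R ^ 2 / 2 + R * Real.sqrt (R ^ 2 / 4 + 1 / (N : ℝ) ^ 2))
              + R * (R / 2 + Real.sqrt (R ^ 2 / 4 + 1 / (N : ℝ) ^ 2)) ^ 2))) / 2)
          + ((N : ℝ) ^ 2 / (2 * ((N : ℝ) ^ 2 - 4))) * R + 2 * (((N : ℝ) ^ 2 / (2 * ((N : ℝ) ^ 2 - 4))) + 1 / 4) * (R ^ 2 / 2 + R * Real.sqrt (R ^ 2 / 4 + 1 / (N : ℝ) ^ 2))
          + ((5 * ((N : ℝ) ^ 2 / (2 * ((N : ℝ) ^ 2 - 4))) + 1 / 4) * R ^ 2 + (10 * ((N : ℝ) ^ 2 / (2 * ((N : ℝ) ^ 2 - 4))) + 1 / 2) * R * (R ^ 2 / 2 + R * Real.sqrt (R ^ 2 / 4 + 1 / (N : ℝ) ^ 2))) / (1 / 2 - R))) := by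
  classical
  intro B B' hB hB' φ L hφm hφb hL hφL
  have hN0 : N ≠ 0 := by omega
  have hNpos : (0 : ℝ) < N := Nat.cast_pos.2 (Nat.pos_of_ne_zero hN0)
  set f : SUN N → ℝ := fun g => (N : ℝ) * ((g : Matrix (Fin N) (Fin N) ℂ) * B).trace.re with hf
  set w : SUN N → ℝ := fun g => (N : ℝ) * ((g : Matrix (Fin N) (Fin N) ℂ) * (B' - B)).trace.re with hw
  have hfw : (fun g : SUN N => (N : ℝ) * ((g : Matrix (Fin N) (Fin N) ℂ) * B').trace.re) = fun g => f g + w g := by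
    funext g
    simp only [hf, hw, Matrix.mul_sub, trace_sub, Complex.sub_re]
    ring
  rw [hfw, abs_sub_comm]
  have hfm : Measurable f := (continuous_const.mul (continuous_re_trace_su_mul B)).measurable
  have hwm : Measurable w := (continuous_const.mul (continuous_re_trace_su_mul (B' - B))).measurable
  have hfb : ∃ C, ∀ s, |f s| ≤ C := ⟨(N : ℝ) * (Real.sqrt N * frobNorm B), fun s => by
    simp only [hf]
    rw [abs_mul, abs_of_nonneg hNpos.le]
    exact mul_le_mul_of_nonneg_left (abs_re_trace_su_mul_le s B) hNpos.le⟩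
  have hwb : ∀ s, |w s| ≤ (N : ℝ) * (Real.sqrt N * frobNorm (B' - B)) := fun s => by
    simp only [hw]
    rw [abs_mul, abs_of_nonneg hNpos.le]
    exact mul_le_mul_of_nonneg_left (abs_re_trace_su_mul_le s _) hNpos.le
  have key := abs_integral_tilted_add_sub_le_of_cov (μ := haarProbability (SUN N))
    (A := (((N : ℝ) ^ 2 / ((N : ℝ) ^ 2 - 1)) *
        (Real.sqrt ((1 +
            (2 * ((N : ℝ) * (2 * (N : ℝ) - 4 / N) / ((2 * (N : ℝ) - 4 / N) ^ 2 - 4)) *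
            (R + (R ^ 2 / 2 + R * Real.sqrt (R ^ 2 / 4 + 1 / (N : ℝ) ^ 2)))
          + 2 * (2 * (N : ℝ) / ((2 * (N : ℝ) - 4 / N) ^ 2 - 4)) * N *
            ((R ^ 2 / 2 + R * Real.sqrt (R ^ 2 / 4 + 1 / (N : ℝ) ^ 2))
              + R * (R / 2 + Real.sqrt (R ^ 2 / 4 + 1 / (N : ℝ) ^ 2)) ^ 2))) / 2)
          + ((N : ℝ) ^ 2 / (2 * ((N : ℝ) ^ 2 - 4))) * R + 2 * (((N : ℝ) ^ 2 / (2 * ((N : ℝ) ^ 2 - 4))) + 1 / 4) * (R ^ 2 / 2 + R * Real.sqrt (R ^ 2 / 4 + 1 / (N : ℝ) ^ 2))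
          + ((5 * ((N : ℝ) ^ 2 / (2 * ((N : ℝ) ^ 2 - 4))) + 1 / 4) * R ^ 2 + (10 * ((N : ℝ) ^ 2 / (2 * ((N : ℝ) ^ 2 - 4))) + 1 / 2) * R * (R ^ 2 / 2 + R * Real.sqrt (R ^ 2 / 4 + 1 / (N : ℝ) ^ 2))) / (1 / 2 - R))) * L * frobNorm (B' - B))
    hfm hfb hwm hwb hφm hφb ?_
  · rw [frobNorm_sub_comm] at key
    exact key
  · intro t ht
    set Bt : Matrix (Fin N) (Fin N) ℂ := B + (t : ℂ) • (B' - B) with hBt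
    have hft : (fun u : SUN N => f u + t * w u) =
        fun g : SUN N => (N : ℝ) * ((g : Matrix (Fin N) (Fin N) ℂ) * Bt).trace.re := by
      funext g
      simp only [hf, hw, hBt, Matrix.mul_add, Matrix.mul_smul, trace_add, trace_smul, Complex.add_re, smul_eq_mul,
        Complex.re_ofReal_mul]
      ring
    have hBt_le : matrixOpNorm Bt ≤ R := by
      have h1 : Bt = ((1 - t : ℝ) : ℂ) • B + ((t : ℝ) : ℂ) • B' := by
        rw [hBt]; push_cast; simp only [smul_sub, sub_smul, one_smul]; abel
      rw [h1]
      calc matrixOpNorm (((1 - t : ℝ) : ℂ) • B + ((t : ℝ) : ℂ) • B')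
          ≤ matrixOpNorm (((1 - t : ℝ) : ℂ) • B) + matrixOpNorm (((t : ℝ) : ℂ) • B') := matrixOpNorm_add_le _ _
        _ = (1 - t) * matrixOpNorm B + t * matrixOpNorm B' := by
            rw [matrixOpNorm_smul, matrixOpNorm_smul, Complex.norm_real, Complex.norm_real, Real.norm_eq_abs,
              Real.norm_eq_abs, abs_of_nonneg (by linarith [ht.2]), abs_of_nonneg ht.1]
        _ ≤ (1 - t) * R + t * R :=
            add_le_add (mul_le_mul_of_nonneg_left hB (by linarith [ht.2])) (mul_le_mul_of_nonneg_left hB' ht.1)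
        _ = R := by ring
    have hBt_lt : matrixOpNorm Bt < 1 / 2 := lt_of_le_of_lt hBt_le hR
    have hcov := cov_linear_le_levelTwoO_explicit hN hBt_lt (B' - B) φ hφm hφb hL hφL
    rw [← hft] at hcov
    refine hcov.trans ?_
    have hmono := levelTwoOBody_mono hN (matrixOpNorm_nonneg Bt) hBt_le hR
    exact mul_le_mul_of_nonneg_right (mul_le_mul_of_nonneg_right hmono hL) (frobNorm_nonneg _)

end Summit.Ventures.YMGap.OneLinkEigen
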